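import Literature.NumberTheory.Automorphic.UnitaryGroupTorusRankOneInterval
import Literature.NumberTheory.Automorphic.UnitaryGroupTorusRayTwo
import Literature.NumberTheory.Automorphic.UnitaryGroupBorelHeightBigCellTwo
import HarnessLib

/-!
# The rank-one interval of the weighted hyperbolic term on `U(J₂)`:
# `∫_{T(F)\T(𝔸)} u_T(t y) dt = C · (2 log T − log H(y) − log H(w y))` (`H`-side copy)
(Rogawski, *Automorphic Representations of Unitary Groups in Three Variables* (1990), §6.1,
(6.1.1)–(6.1.3): the weight `W(g) = 2T − H(m) − H(wn)` of the hyperbolic term; §7.3 pp. 97–98 (the same term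
for `H = U(2) × U(1)`); Arthur, *A trace formula for reductive groups I*, Duke Math. J. 45 (1978), §8)

Topic `NumberTheory/Automorphic`; namespace `Literature.NumberTheory.Automorphic.UnitaryGroup`. THEOREMS
ONLY over accepted tree modules (no definition, no named fact, no instance, no notation, no `sorry`).
Item (σ-h) (R2) of the `H`-side copy of LAWS 1–5 (census `CENSUS-LAWS-Hside` §3 LAW 5 (σ-h)) of the T1-qs road
of `Cruxes/H413/Lines/F0_T1InnerFormTraceIdentity.lean` (cell `pub/hodgecm-mathlib`, crux H413): the `N = 2`
twin of ★ `UnitaryGroupTorusRankOneInterval` §§1, 2, 4, 5, 6 (its §3 «closed windows from half-open windows»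
is rank-free and IMPORTED), token-parallel, with the Weyl element `w = J₂` (`hw : ↑↑w = !![0,1;1,0]`), the torus
letters over ★ `UnitaryGroupTorusRayTwo` (`adelicVal_torus_eq_glDiagonal_diagUnit_two`, `exists_torusSiegelData_two`)
and the big-cell inequality ★ `borelHeight_mul_borelHeight_le_one_of_not_mem_borelAdelic_two`
(★ `UnitaryGroupBorelHeightBigCellTwo`).

THE STATEMENT. For a height cut-off `T ≥ 1` and an adelic point `y`, Arthur's weight of the regular hyperbolic
term is `u_T(y) := 1 − 1_{T < H(y)} − 1_{T < H(w y)}` (INLINE, Mathlib's `Set.indicator`), `H = borelHeight`.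
Along the adelic diagonal torus `t ∈ T(𝔸_F)` (★ `torusInBorel F E c 2`, `t = d(d₀, (c d₀)⁻¹)`) one has
`H(t y) = ‖d₀(t)‖ H(y)` and `H(w t y) = ‖d₀(t)‖⁻¹ H(w y)` (`w t w⁻¹ = d(d₁, d₀)`), the two cut-offs are DISJOINT
because `H(w y) · H(y) ≤ 1 ≤ T²`, hence `u_T(t y)` is the indicator of a HEIGHT WINDOW on the torus (§2) and the
rank-free window law ★ `exists_lintegral_weight_mul_indicator_window_eq` evaluates `∫_{T(F)\T(𝔸)} u_T(t y) dt` as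
`C · (2 log T − log H(y) − log H(w y))`.

* §1 torus letters (+ 1 private plumbing lemma): `borelHeight_torus_coe_mul_two` (`H(t y) = ‖d₀ t‖ H(y)`),
  `borelHeight_torus_coe_two`, `coe_adelicVal_toAdelic_weyl_two`, `toAdelic_weyl_mul_self_two`,
  `borelHeight_toAdelic_weyl_mul_mul_le_one_two` (`H(w y) H(y) ≤ 1`), `glDiagonal_rev_eq_adelicVal_weyl_conj_two`
  (`w · diag(d₀,d₁) · w = diag(d₁,d₀)` adelically), `borelHeight_toAdelic_weyl_mul_torus_coe_mul_two`
  (`H(w t y) = ‖d₀ t‖⁻¹ H(w y)`).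
* §2 **`uT_torus_coe_mul_eq_indicator_two`** — `u_T(t y)` is the indicator of the window
  `{H(1) H(w y)/T ≤ H(t) ≤ H(1) T/H(y)}` for `T ≥ 1`.
* §4 **`lintegral_weight_mul_indicator_rankOneWindow_eq_two`** (`[0,∞]` form) and
  **`integral_weight_toReal_mul_uT_eq_two`** (signed form), `C`-PARAMETRIC in the window law.
* §5 **`exists_rankOneInterval_two`** — the packaged `∃ C ≠ ⊤` form (`[E:F] = 2`, `c² = 1`, `c ≠ 1`) from ★
  `exists_torusSiegelData_two` + ★ `exists_lintegral_weight_mul_indicator_window_eq`.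
* §6 `lintegral_weight_mul_indicator_window_eq_of_isCoveringWeight_two`, **`exists_rankOneInterval_forall_weight_two`**
  — ONE `C` for EVERY covering weight `β` of `T(F)_T`.

## References
* J. D. Rogawski, *Automorphic Representations of Unitary Groups in Three Variables*, Ann. of Math.
  Stud. 123 (1990), §6.1 pp. 79–80, (6.1.1)–(6.1.3); §7.3 pp. 97–98 [Rogawski1990].
* J. Arthur, *A trace formula for reductive groups I*, Duke Math. J. 45 (1978), §8 [Arthur1978TraceFormulaI].
* J. Arthur, *The trace formula in invariant form*, Ann. of Math. 114 (1981), §2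
  [Arthur1981TraceFormulaInvariantForm].
-/

set_option autoImplicit false

noncomputable section

open MeasureTheory Measure NumberField IsDedekindDomain Set Filter Literature.MeasureTheory.Group
open scoped NNReal ENNReal Pointwise Topology

namespace Literature.NumberTheory.Automorphic

namespace UnitaryGroup

variable {F E : Type} [Field F] [NumberField F] [Field E] [NumberField E] [Algebra F E]
  {c : E ≃ₐ[F] E}

/-! ## §1 Torus letters: heights along `T(𝔸_F)` and the Weyl flip -/

section Torus

/-- **`H(t y) = ‖d₀(t)‖ · H(y)`** for `t ∈ T(𝔸_F)` (★ `borelHeight_torus_mul'` in the coordinates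
★ `adelicVal_torus_eq_glDiagonal_diagUnit_two`). [cite: Rogawski1990, §2.2] -/
theorem borelHeight_torus_coe_mul_two (t : torusInBorel F E c 2) (y : (quasiSplit F E c 2).Adelic) :
    borelHeight (((t : borelAdelic F E c 2) : (quasiSplit F E c 2).Adelic) * y) =
      IdeleClassGroup.ideleNorm E (diagUnit (t : borelAdelic F E c 2).2 0) * borelHeight y :=
  borelHeight_torus_mul' (adelicVal_torus_eq_glDiagonal_diagUnit_two t).symm y

/-- **`H(t) = ‖d₀(t)‖ · H(1)`** for `t ∈ T(𝔸_F)`. [cite: Rogawski1990, §2.2] -/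
theorem borelHeight_torus_coe_two (t : torusInBorel F E c 2) :
    borelHeight (((t : borelAdelic F E c 2) : (quasiSplit F E c 2).Adelic)) =
      IdeleClassGroup.ideleNorm E (diagUnit (t : borelAdelic F E c 2).2 0) *
        borelHeight (1 : (quasiSplit F E c 2).Adelic) := by
  rw [← borelHeight_torus_coe_mul_two t 1, mul_one]

/-- `‖d₀(t)‖ ≠ 0` (plumbing). [folklore] -/
private theorem ideleNorm_diagUnit_ne_zero_two (t : torusInBorel F E c 2) :
    IdeleClassGroup.ideleNorm E (diagUnit (t : borelAdelic F E c 2).2 0) ≠ 0 :=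
  ideleNorm_ne_zero _

/-- The adelic matrix of the Weyl element: `ι(w) = !![0,1;1,0]` over `𝔸_E`.
[cite: Rogawski1990, §6.1 (p. 80)] -/
theorem coe_adelicVal_toAdelic_weyl_two {w : (quasiSplit F E c 2).Rational}
    (hw : ((w.1 : GL (Fin 2) E) : Matrix (Fin 2) (Fin 2) E) = !![(0 : E), 1; 1, 0]) :
    ((adelicVal F E c 2 _ ((quasiSplit F E c 2).toAdelic w) : GL (Fin 2) (AdeleRing (𝓞 E) E)) :
        Matrix (Fin 2) (Fin 2) (AdeleRing (𝓞 E) E)) =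
      !![(0 : AdeleRing (𝓞 E) E), 1; 1, 0] := by
  have h : ((adelicVal F E c 2 _ ((quasiSplit F E c 2).toAdelic w) : GL (Fin 2) (AdeleRing (𝓞 E) E)) :
        Matrix (Fin 2) (Fin 2) (AdeleRing (𝓞 E) E)) =
      ((w.1 : GL (Fin 2) E) : Matrix (Fin 2) (Fin 2) E).map (algebraMap E (AdeleRing (𝓞 E) E)) := rfl
  rw [h, hw]
  ext i j
  fin_cases i <;> fin_cases j <;> simp

/-- **`ι(w)² = 1`** in `U(J₂)(𝔸_F)`. [cite: Rogawski1990, §6.1 (p. 80)] -/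
theorem toAdelic_weyl_mul_self_two {w : (quasiSplit F E c 2).Rational}
    (hw : ((w.1 : GL (Fin 2) E) : Matrix (Fin 2) (Fin 2) E) = !![(0 : E), 1; 1, 0]) :
    (quasiSplit F E c 2).toAdelic w * (quasiSplit F E c 2).toAdelic w = 1 := by
  apply adelicVal_injective F E c 2 _
  apply Units.ext
  rw [map_mul, map_one, Units.val_mul, coe_adelicVal_toAdelic_weyl_two hw, Units.val_one]
  ext i j
  fin_cases i <;> fin_cases j <;> simp [Matrix.mul_apply, Fin.sum_univ_two]

/-- **`H(w y) · H(y) ≤ 1`** for the Weyl element (`ι(w) ∉ B(𝔸_F)` since `w₁₀ = 1 ≠ 0`, and ★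
`borelHeight_mul_borelHeight_le_one_of_not_mem_borelAdelic_two`). [cite: Rogawski1990, §2.2 (p. 13)] -/
theorem borelHeight_toAdelic_weyl_mul_mul_le_one_two {w : (quasiSplit F E c 2).Rational}
    (hw : ((w.1 : GL (Fin 2) E) : Matrix (Fin 2) (Fin 2) E) = !![(0 : E), 1; 1, 0])
    (y : (quasiSplit F E c 2).Adelic) :
    borelHeight ((quasiSplit F E c 2).toAdelic w * y) * borelHeight y ≤ 1 := by
  refine borelHeight_mul_borelHeight_le_one_of_not_mem_borelAdelic_two (fun h => ?_) y
  have h10 := (mem_borelAdelic_iff _).1 h (show ((0 : Fin 2) : Fin 2) < 1 by decide)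
  rw [coe_adelicVal_toAdelic_weyl_two hw] at h10
  haveI : Nontrivial (AdeleRing (𝓞 E) E) :=
    inferInstanceAs (Nontrivial (InfiniteAdeleRing E × FiniteAdeleRing (𝓞 E) E))
  simp at h10

/-- **`w · diag(d₀, d₁) · w = diag(d₁, d₀)` on `T(𝔸_F)`**: the conjugate of a torus element by
the Weyl element is the torus element with reversed diagonal. [cite: Rogawski1990, §6.1 (p. 80)] -/
theorem glDiagonal_rev_eq_adelicVal_weyl_conj_two {w : (quasiSplit F E c 2).Rational}
    (hw : ((w.1 : GL (Fin 2) E) : Matrix (Fin 2) (Fin 2) E) = !![(0 : E), 1; 1, 0])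
    (t : torusInBorel F E c 2) :
    glDiagonal 2 (AdeleRing (𝓞 E) E)
        ![diagUnit (t : borelAdelic F E c 2).2 1, diagUnit (t : borelAdelic F E c 2).2 0] =
      adelicVal F E c 2 _ ((quasiSplit F E c 2).toAdelic w *
        ((t : borelAdelic F E c 2) : (quasiSplit F E c 2).Adelic) * (quasiSplit F E c 2).toAdelic w) := by
  apply Units.ext
  rw [map_mul, map_mul, Units.val_mul, Units.val_mul, coe_adelicVal_toAdelic_weyl_two hw,
    adelicVal_torus_eq_glDiagonal_diagUnit_two, coe_glDiagonal, coe_glDiagonal]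
  ext i j
  rw [Matrix.mul_apply]
  simp_rw [Matrix.mul_apply]
  fin_cases i <;> fin_cases j <;> simp [Fin.sum_univ_two, Matrix.diagonal, -coe_diagUnit]

/-- **`H(w t y) = ‖d₀(t)‖⁻¹ · H(w y)`** for `t ∈ T(𝔸_F)`: `w t y = (w t w)(w y)` with `w t w = d(d₁,d₀)`
and ★ `borelHeight_torus_mul` (`H(diag(d) g) = ‖d₁‖⁻¹ H(g)`). [cite: Rogawski1990, §6.1 (pp. 79–80)] -/
theorem borelHeight_toAdelic_weyl_mul_torus_coe_mul_two {w : (quasiSplit F E c 2).Rational}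
    (hw : ((w.1 : GL (Fin 2) E) : Matrix (Fin 2) (Fin 2) E) = !![(0 : E), 1; 1, 0])
    (t : torusInBorel F E c 2) (y : (quasiSplit F E c 2).Adelic) :
    borelHeight ((quasiSplit F E c 2).toAdelic w *
        (((t : borelAdelic F E c 2) : (quasiSplit F E c 2).Adelic) * y)) =
      (IdeleClassGroup.ideleNorm E (diagUnit (t : borelAdelic F E c 2).2 0))⁻¹ *
        borelHeight ((quasiSplit F E c 2).toAdelic w * y) := by
  have hww := toAdelic_weyl_mul_self_two hw
  have heq : (quasiSplit F E c 2).toAdelic w * (((t : borelAdelic F E c 2) : (quasiSplit F E c 2).Adelic) * y) =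
      ((quasiSplit F E c 2).toAdelic w * ((t : borelAdelic F E c 2) : (quasiSplit F E c 2).Adelic) *
        (quasiSplit F E c 2).toAdelic w) * ((quasiSplit F E c 2).toAdelic w * y) := by
    rw [mul_assoc, mul_assoc, ← mul_assoc ((quasiSplit F E c 2).toAdelic w) ((quasiSplit F E c 2).toAdelic w) y,
      hww, one_mul]
  rw [heq, borelHeight_torus_mul (glDiagonal_rev_eq_adelicVal_weyl_conj_two hw t)]
  rfl

end Torus

/-! ## §2 `u_T(t y)` is the indicator of a height window on the torus -/

section Window

/-- **THE RANK-ONE WINDOW.** For the Weyl element `w` (`hw`), `T ≥ 1`, `t ∈ T(𝔸_F)` and `y ∈ G(𝔸_F)`: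
`u_T(t y) := 1 − 1_{T < H(t y)} − 1_{T < H(w t y)} = 1_{[H(1)·H(wy)/T, H(1)·T/H(y)]}(H(t))` — the two
cut-offs `{T < ‖d₀ t‖ H(y)}` and `{T < ‖d₀ t‖⁻¹ H(w y)}` are disjoint because `H(w y) · H(y) ≤ 1 ≤ T²`
(★ `borelHeight_mul_borelHeight_le_one_of_not_mem_borelAdelic_two`), and `H(t) = ‖d₀ t‖ · H(1)`
(Rogawski (1990), §6.1: `v_M(x)` is the length of the interval `[H(wn) − T, T − H(m)]`).
[cite: Rogawski1990, §6.1 (pp. 79–80)] [cite: Arthur1978TraceFormulaI, §8] -/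
theorem uT_torus_coe_mul_eq_indicator_two {w : (quasiSplit F E c 2).Rational}
    (hw : ((w.1 : GL (Fin 2) E) : Matrix (Fin 2) (Fin 2) E) = !![(0 : E), 1; 1, 0])
    {T : ℝ≥0} (hT : 1 ≤ T) (t : torusInBorel F E c 2) (y : (quasiSplit F E c 2).Adelic) :
    (1 : ℝ) - {g : (quasiSplit F E c 2).Adelic | T < borelHeight g}.indicator 1
        (((t : borelAdelic F E c 2) : (quasiSplit F E c 2).Adelic) * y) -
      {g : (quasiSplit F E c 2).Adelic | T < borelHeight g}.indicator 1
        ((quasiSplit F E c 2).toAdelic w * (((t : borelAdelic F E c 2) : (quasiSplit F E c 2).Adelic) * y)) =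
      {t : torusInBorel F E c 2 |
          borelHeight (1 : (quasiSplit F E c 2).Adelic) * borelHeight ((quasiSplit F E c 2).toAdelic w * y) / T ≤
            borelHeight (((t : torusInBorel F E c 2) : borelAdelic F E c 2) : (quasiSplit F E c 2).Adelic) ∧
          borelHeight (((t : torusInBorel F E c 2) : borelAdelic F E c 2) : (quasiSplit F E c 2).Adelic) ≤
            borelHeight (1 : (quasiSplit F E c 2).Adelic) * T / borelHeight y}.indicator 1 t := by
  -- the letters
  set n : ℝ≥0 := IdeleClassGroup.ideleNorm E (diagUnit (t : borelAdelic F E c 2).2 0) with hn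
  set H₁ : ℝ≥0 := borelHeight (1 : (quasiSplit F E c 2).Adelic) with hH₁
  set Hy : ℝ≥0 := borelHeight y with hHy
  set Hwy : ℝ≥0 := borelHeight ((quasiSplit F E c 2).toAdelic w * y) with hHwy
  have hn0 : 0 < n := pos_iff_ne_zero.2 (ideleNorm_diagUnit_ne_zero_two t)
  have hH₁0 : 0 < H₁ := borelHeight_pos _
  have hHy0 : 0 < Hy := borelHeight_pos _
  have hT0 : 0 < T := lt_of_lt_of_le one_pos hT
  have hle1 : Hwy * Hy ≤ 1 := borelHeight_toAdelic_weyl_mul_mul_le_one_two hw y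
  have hty : borelHeight (((t : borelAdelic F E c 2) : (quasiSplit F E c 2).Adelic) * y) = n * Hy :=
    borelHeight_torus_coe_mul_two t y
  have hwty : borelHeight ((quasiSplit F E c 2).toAdelic w *
      (((t : borelAdelic F E c 2) : (quasiSplit F E c 2).Adelic) * y)) = n⁻¹ * Hwy :=
    borelHeight_toAdelic_weyl_mul_torus_coe_mul_two hw t y
  have ht : borelHeight (((t : borelAdelic F E c 2) : (quasiSplit F E c 2).Adelic)) = n * H₁ :=
    borelHeight_torus_coe_two t
  -- the window in the coordinate `n = ‖d₀ t‖`
  have hwin_iff : (H₁ * Hwy / T ≤ borelHeight (((t : borelAdelic F E c 2) : (quasiSplit F E c 2).Adelic)) ∧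
      borelHeight (((t : borelAdelic F E c 2) : (quasiSplit F E c 2).Adelic)) ≤ H₁ * T / Hy) ↔
      (¬ T < n⁻¹ * Hwy ∧ ¬ T < n * Hy) := by
    rw [ht, not_lt, not_lt, div_le_iff₀ hT0, le_div_iff₀ hHy0]
    constructor
    · rintro ⟨h1, h2⟩
      refine ⟨?_, ?_⟩
      · -- `H₁ Hwy ≤ n H₁ T` ⇒ `n⁻¹ Hwy ≤ T`
        rw [inv_mul_le_iff₀ hn0]
        have h1' : H₁ * Hwy ≤ H₁ * (n * T) := by
          calc H₁ * Hwy ≤ n * H₁ * T := h1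
            _ = H₁ * (n * T) := by ring
        exact le_of_mul_le_mul_left h1' hH₁0
      · have h2' : H₁ * (n * Hy) ≤ H₁ * T := by
          calc H₁ * (n * Hy) = n * H₁ * Hy := by ring
            _ ≤ H₁ * T := h2
        exact le_of_mul_le_mul_left h2' hH₁0
    · rintro ⟨h1, h2⟩
      refine ⟨?_, ?_⟩
      · rw [inv_mul_le_iff₀ hn0] at h1
        calc H₁ * Hwy ≤ H₁ * (n * T) := mul_le_mul_of_nonneg_left h1 zero_le
          _ = n * H₁ * T := by ring
      · calc n * H₁ * Hy = H₁ * (n * Hy) := by ring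
          _ ≤ H₁ * T := mul_le_mul_of_nonneg_left h2 zero_le
  -- disjointness of the two cut-offs
  have hdisj : T < n * Hy → ¬ T < n⁻¹ * Hwy := by
    intro h1 h2
    have h12 : T * T < n * Hy * (n⁻¹ * Hwy) := mul_lt_mul'' h1 h2 zero_le zero_le
    have heq : n * Hy * (n⁻¹ * Hwy) = Hwy * Hy := by
      rw [mul_comm n Hy, mul_assoc, ← mul_assoc n, mul_inv_cancel₀ hn0.ne', one_mul, mul_comm]
    rw [heq] at h12
    have hT2 : (1 : ℝ≥0) ≤ T * T := by
      calc (1 : ℝ≥0) = 1 * 1 := (mul_one 1).symm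
        _ ≤ T * T := mul_le_mul' hT hT
    exact absurd (lt_of_le_of_lt hT2 (lt_of_lt_of_le h12 hle1)) (lt_irrefl 1)
  -- evaluate both sides
  simp only [Set.indicator_apply, Set.mem_setOf_eq, hty, hwty, hwin_iff, Pi.one_apply]
  by_cases h1 : T < n * Hy
  · have h2 := hdisj h1
    simp [h1, h2]
  · by_cases h2 : T < n⁻¹ * Hwy
    · simp [h1, h2]
    · simp [h1, h2]

end Window

/-! ## §4 The rank-one interval: `[0, ∞]` form and signed form (constant-parametric) -/

section Interval

variable [MeasurableSpace (quasiSplit F E c 2).Adelic] [BorelSpace (quasiSplit F E c 2).Adelic]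

/-- **THE RANK-ONE INTERVAL, `[0,∞]` FORM.** For the Weyl element `w` (`hw`), `y ∈ G(𝔸_F)`, `T ≥ 1`,
a measure `μ_T` on `T(𝔸_F)`, a measurable weight `β` and a constant `C < ∞` obeying the torus WINDOW LAW
`∫⁻ β · 1_{A < H ≤ B} dμ_T = C · (log B − log A)` (★ `exists_lintegral_weight_mul_indicator_window_eq`):
`∫⁻ β(t) · 1_{[H(1) H(wy)/T, H(1) T/H(y)]}(H(t)) dμ_T(t) = C · (2 log T − log H(y) − log H(w y))` — by §2
the integrand is `β(t) · u_T(t y)`; Rogawski (1990), (6.1.2)–(6.1.3): `∫ v_M = 2T − H(m) − H(wn)` in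
additive notation. [cite: Rogawski1990, §6.1 (6.1.2)–(6.1.3)] [cite: Arthur1978TraceFormulaI, §8] -/
theorem lintegral_weight_mul_indicator_rankOneWindow_eq_two {w : (quasiSplit F E c 2).Rational}
    (hw : ((w.1 : GL (Fin 2) E) : Matrix (Fin 2) (Fin 2) E) = !![(0 : E), 1; 1, 0])
    (y : (quasiSplit F E c 2).Adelic) {T : ℝ≥0} (hT : 1 ≤ T)
    (μT : Measure (torusInBorel F E c 2)) {β : torusInBorel F E c 2 → ℝ≥0∞} (hβ : Measurable β)
    {C : ℝ≥0∞} (hC : C ≠ ⊤)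
    (hwin : ∀ A B : ℝ≥0, 0 < A → A ≤ B →
      ∫⁻ t, β t * {t : torusInBorel F E c 2 |
          A < borelHeight (((t : torusInBorel F E c 2) : borelAdelic F E c 2) : (quasiSplit F E c 2).Adelic) ∧
          borelHeight (((t : torusInBorel F E c 2) : borelAdelic F E c 2) : (quasiSplit F E c 2).Adelic) ≤ B}.indicator
          1 t ∂μT =
        C * ENNReal.ofReal (Real.log (B : ℝ) - Real.log (A : ℝ))) :
    ∫⁻ t, β t * {t : torusInBorel F E c 2 |
        borelHeight (1 : (quasiSplit F E c 2).Adelic) * borelHeight ((quasiSplit F E c 2).toAdelic w * y) / T ≤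
          borelHeight (((t : torusInBorel F E c 2) : borelAdelic F E c 2) : (quasiSplit F E c 2).Adelic) ∧
        borelHeight (((t : torusInBorel F E c 2) : borelAdelic F E c 2) : (quasiSplit F E c 2).Adelic) ≤
          borelHeight (1 : (quasiSplit F E c 2).Adelic) * T / borelHeight y}.indicator 1 t ∂μT =
      C * ENNReal.ofReal (2 * Real.log (T : ℝ) - Real.log (borelHeight y : ℝ) -
        Real.log (borelHeight ((quasiSplit F E c 2).toAdelic w * y) : ℝ)) := by
  set H₁ : ℝ≥0 := borelHeight (1 : (quasiSplit F E c 2).Adelic) with hH₁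
  set Hy : ℝ≥0 := borelHeight y with hHy
  set Hwy : ℝ≥0 := borelHeight ((quasiSplit F E c 2).toAdelic w * y) with hHwy
  have hH₁0 : 0 < H₁ := borelHeight_pos _
  have hHy0 : 0 < Hy := borelHeight_pos _
  have hHwy0 : 0 < Hwy := borelHeight_pos _
  have hT0 : 0 < T := lt_of_lt_of_le one_pos hT
  have hle1 : Hwy * Hy ≤ 1 := borelHeight_toAdelic_weyl_mul_mul_le_one_two hw y
  -- the window `[A, B]`
  have hA : 0 < H₁ * Hwy / T := div_pos (mul_pos hH₁0 hHwy0) hT0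
  have hAB : H₁ * Hwy / T ≤ H₁ * T / Hy := by
    rw [div_le_div_iff₀ hT0 hHy0]
    calc H₁ * Hwy * Hy = H₁ * (Hwy * Hy) := mul_assoc _ _ _
      _ ≤ H₁ * 1 := mul_le_mul_of_nonneg_left hle1 zero_le
      _ ≤ H₁ * (T * T) := mul_le_mul_of_nonneg_left (by
          calc (1 : ℝ≥0) = 1 * 1 := (mul_one 1).symm
            _ ≤ T * T := mul_le_mul' hT hT) zero_le
      _ = H₁ * T * T := (mul_assoc _ _ _).symm
  rw [lintegral_weight_mul_indicator_Icc_eq μT hβ hC hwin hA hAB]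
  congr 2
  rw [NNReal.coe_div, NNReal.coe_div, NNReal.coe_mul, NNReal.coe_mul,
    Real.log_div (mul_pos (NNReal.coe_pos.2 hH₁0) (NNReal.coe_pos.2 hT0)).ne' (NNReal.coe_pos.2 hHy0).ne',
    Real.log_div (mul_pos (NNReal.coe_pos.2 hH₁0) (NNReal.coe_pos.2 hHwy0)).ne' (NNReal.coe_pos.2 hT0).ne',
    Real.log_mul (NNReal.coe_pos.2 hH₁0).ne' (NNReal.coe_pos.2 hT0).ne',
    Real.log_mul (NNReal.coe_pos.2 hH₁0).ne' (NNReal.coe_pos.2 hHwy0).ne']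
  ring

/-- **THE RANK-ONE INTERVAL, SIGNED FORM.** With `u_T(y) := 1 − 1_{T < H(y)} − 1_{T < H(w y)}` INLINE:
`∫ β(t) · u_T(t y) dμ_T(t) = C · (2 log T − log H(y) − log H(w y))` (as real numbers; the right-hand side is
`≥ 0` since `H(w y) H(y) ≤ 1 ≤ T²`). [cite: Rogawski1990, §6.1 (6.1.2)–(6.1.3)] [cite: Arthur1978TraceFormulaI, §8] -/
theorem integral_weight_toReal_mul_uT_eq_two {w : (quasiSplit F E c 2).Rational}
    (hw : ((w.1 : GL (Fin 2) E) : Matrix (Fin 2) (Fin 2) E) = !![(0 : E), 1; 1, 0])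
    (y : (quasiSplit F E c 2).Adelic) {T : ℝ≥0} (hT : 1 ≤ T)
    (μT : Measure (torusInBorel F E c 2)) {β : torusInBorel F E c 2 → ℝ≥0∞} (hβ : Measurable β)
    {C : ℝ≥0∞} (hC : C ≠ ⊤)
    (hwin : ∀ A B : ℝ≥0, 0 < A → A ≤ B →
      ∫⁻ t, β t * {t : torusInBorel F E c 2 |
          A < borelHeight (((t : torusInBorel F E c 2) : borelAdelic F E c 2) : (quasiSplit F E c 2).Adelic) ∧
          borelHeight (((t : torusInBorel F E c 2) : borelAdelic F E c 2) : (quasiSplit F E c 2).Adelic) ≤ B}.indicator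
          1 t ∂μT =
        C * ENNReal.ofReal (Real.log (B : ℝ) - Real.log (A : ℝ))) :
    ∫ t, (β t).toReal *
        ((1 : ℝ) - {g : (quasiSplit F E c 2).Adelic | T < borelHeight g}.indicator 1
            ((((t : torusInBorel F E c 2) : borelAdelic F E c 2) : (quasiSplit F E c 2).Adelic) * y) -
          {g : (quasiSplit F E c 2).Adelic | T < borelHeight g}.indicator 1
            ((quasiSplit F E c 2).toAdelic w *
              ((((t : torusInBorel F E c 2) : borelAdelic F E c 2) : (quasiSplit F E c 2).Adelic) * y))) ∂μT =
      C.toReal * (2 * Real.log (T : ℝ) - Real.log (borelHeight y : ℝ) -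
        Real.log (borelHeight ((quasiSplit F E c 2).toAdelic w * y) : ℝ)) := by
  -- the window and its indicator
  set W : Set (torusInBorel F E c 2) := {t : torusInBorel F E c 2 |
      borelHeight (1 : (quasiSplit F E c 2).Adelic) * borelHeight ((quasiSplit F E c 2).toAdelic w * y) / T ≤
        borelHeight (((t : torusInBorel F E c 2) : borelAdelic F E c 2) : (quasiSplit F E c 2).Adelic) ∧
      borelHeight (((t : torusInBorel F E c 2) : borelAdelic F E c 2) : (quasiSplit F E c 2).Adelic) ≤
        borelHeight (1 : (quasiSplit F E c 2).Adelic) * T / borelHeight y} with hWdef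
  have hHm : Measurable fun t : torusInBorel F E c 2 =>
      borelHeight (((t : torusInBorel F E c 2) : borelAdelic F E c 2) : (quasiSplit F E c 2).Adelic) :=
    measurable_borelHeight.comp (measurable_subtype_coe.comp measurable_subtype_coe)
  have hW1 : MeasurableSet {t : torusInBorel F E c 2 |
      borelHeight (1 : (quasiSplit F E c 2).Adelic) * borelHeight ((quasiSplit F E c 2).toAdelic w * y) / T ≤
        borelHeight (((t : torusInBorel F E c 2) : borelAdelic F E c 2) : (quasiSplit F E c 2).Adelic)} :=
    measurableSet_le measurable_const hHm
  have hW2 : MeasurableSet {t : torusInBorel F E c 2 |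
      borelHeight (((t : torusInBorel F E c 2) : borelAdelic F E c 2) : (quasiSplit F E c 2).Adelic) ≤
        borelHeight (1 : (quasiSplit F E c 2).Adelic) * T / borelHeight y} :=
    measurableSet_le hHm measurable_const
  have hWm : MeasurableSet W := by
    rw [hWdef, Set.setOf_and]
    exact hW1.inter hW2
  -- pointwise: the integrand is `(β · 1_W).toReal`
  have hpt : ∀ t : torusInBorel F E c 2,
      (β t).toReal *
        ((1 : ℝ) - {g : (quasiSplit F E c 2).Adelic | T < borelHeight g}.indicator 1
            ((((t : torusInBorel F E c 2) : borelAdelic F E c 2) : (quasiSplit F E c 2).Adelic) * y) -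
          {g : (quasiSplit F E c 2).Adelic | T < borelHeight g}.indicator 1
            ((quasiSplit F E c 2).toAdelic w *
              ((((t : torusInBorel F E c 2) : borelAdelic F E c 2) : (quasiSplit F E c 2).Adelic) * y))) =
        (β t * W.indicator 1 t).toReal := by
    intro t
    rw [uT_torus_coe_mul_eq_indicator_two hw hT t y, ENNReal.toReal_mul]
    congr 1
    by_cases ht : t ∈ W
    · rw [Set.indicator_of_mem ht, Set.indicator_of_mem ht, Pi.one_apply, Pi.one_apply, ENNReal.toReal_one]
    · rw [Set.indicator_of_notMem ht, Set.indicator_of_notMem ht, ENNReal.toReal_zero]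
  simp_rw [hpt]
  have hmeas : Measurable fun t => β t * W.indicator 1 t := hβ.mul (measurable_one.indicator hWm)
  have hlin := lintegral_weight_mul_indicator_rankOneWindow_eq_two hw y hT μT hβ hC hwin
  have hfin : ∀ᵐ t ∂μT, β t * W.indicator 1 t < ⊤ :=
    ae_lt_top hmeas (by rw [hlin]; exact ENNReal.mul_ne_top hC ENNReal.ofReal_ne_top)
  rw [integral_toReal hmeas.aemeasurable hfin, hlin, ENNReal.toReal_mul, ENNReal.toReal_ofReal]
  -- the right-hand side is non-negative: `H(w y) H(y) ≤ 1 ≤ T²`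
  have hHy0 : 0 < (borelHeight y : ℝ) := NNReal.coe_pos.2 (borelHeight_pos _)
  have hHwy0 : 0 < (borelHeight ((quasiSplit F E c 2).toAdelic w * y) : ℝ) := NNReal.coe_pos.2 (borelHeight_pos _)
  have hT1 : (1 : ℝ) ≤ T := by exact_mod_cast hT
  have hle1 : (borelHeight ((quasiSplit F E c 2).toAdelic w * y) : ℝ) * borelHeight y ≤ 1 := by
    exact_mod_cast borelHeight_toAdelic_weyl_mul_mul_le_one_two hw y
  have hprod : Real.log (borelHeight ((quasiSplit F E c 2).toAdelic w * y) : ℝ) + Real.log (borelHeight y : ℝ) ≤ 0 := by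
    rw [← Real.log_mul hHwy0.ne' hHy0.ne']
    exact Real.log_nonpos (mul_nonneg hHwy0.le hHy0.le) hle1
  have hlogT : 0 ≤ Real.log (T : ℝ) := Real.log_nonneg hT1
  linarith

end Interval

/-! ## §5 The packaged form at `N = 2`: one constant for the window law and the rank-one interval -/

section Packaged

variable [MeasurableSpace (quasiSplit F E c 2).Adelic] [BorelSpace (quasiSplit F E c 2).Adelic]

/-- **THE RANK-ONE INTERVAL OF `U(J₂)` (packaged).** For `[E:F] = 2`, `c² = 1`, `c ≠ 1`, a left-invariant
measure `μ_T` on `T(𝔸_F)` finite on compacts, a covering weight `β` of the rational torus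
`T(F)_T := (rationalBorel F E c 2).subgroupOf (torusInBorel F E c 2)` and the Weyl element `w` (`hw`), there
is ONE constant `C < ∞` with (i) the window law `∫⁻ β · 1_{A < H ≤ B} dμ_T = C · (log B − log A)`
(`0 < A ≤ B`; ★ `exists_lintegral_weight_mul_indicator_window_eq` over ★ `exists_torusSiegelData_two`) and
(ii) for every `y ∈ G(𝔸_F)` and `T ≥ 1` the rank-one interval
`∫ β(t) u_T(t y) dμ_T(t) = C · (2 log T − log H(y) − log H(w y))`, in `[0,∞]` form and in signed form
(`u_T(y) := 1 − 1_{T<H(y)} − 1_{T<H(wy)}` inline) — Rogawski (1990), (6.1.3):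
`J^T_𝔬(f) = c·[2 log T · Φ(γ, f) − ∫ f(y⁻¹γy)(log H(y) + log H(wy)) dy]` once integrated over `T(𝔸)\G(𝔸)`.
[cite: Rogawski1990, §6.1 (6.1.1)–(6.1.3)] [cite: Arthur1978TraceFormulaI, §8]
[cite: Arthur1981TraceFormulaInvariantForm, §2] -/
theorem exists_rankOneInterval_two (h2 : Module.finrank F E = 2) (hc : c * c = 1) (hc1 : c ≠ 1)
    {w : (quasiSplit F E c 2).Rational}
    (hw : ((w.1 : GL (Fin 2) E) : Matrix (Fin 2) (Fin 2) E) = !![(0 : E), 1; 1, 0])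
    (μT : Measure (torusInBorel F E c 2)) [μT.IsMulLeftInvariant] [IsFiniteMeasureOnCompacts μT]
    {β : torusInBorel F E c 2 → ℝ≥0∞}
    (hβ : IsCoveringWeight ((rationalBorel F E c 2).subgroupOf (torusInBorel F E c 2)) β) :
    ∃ C : ℝ≥0∞, C ≠ ⊤ ∧
      (∀ A B : ℝ≥0, 0 < A → A ≤ B →
        ∫⁻ t, β t * {t : torusInBorel F E c 2 |
            A < borelHeight (((t : torusInBorel F E c 2) : borelAdelic F E c 2) : (quasiSplit F E c 2).Adelic) ∧
            borelHeight (((t : torusInBorel F E c 2) : borelAdelic F E c 2) : (quasiSplit F E c 2).Adelic) ≤ B}.indicator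
            1 t ∂μT =
          C * ENNReal.ofReal (Real.log (B : ℝ) - Real.log (A : ℝ))) ∧
      ∀ (y : (quasiSplit F E c 2).Adelic) (T : ℝ≥0), 1 ≤ T →
        ∫⁻ t, β t * {t : torusInBorel F E c 2 |
            borelHeight (1 : (quasiSplit F E c 2).Adelic) * borelHeight ((quasiSplit F E c 2).toAdelic w * y) / T ≤
              borelHeight (((t : torusInBorel F E c 2) : borelAdelic F E c 2) : (quasiSplit F E c 2).Adelic) ∧
            borelHeight (((t : torusInBorel F E c 2) : borelAdelic F E c 2) : (quasiSplit F E c 2).Adelic) ≤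
              borelHeight (1 : (quasiSplit F E c 2).Adelic) * T / borelHeight y}.indicator 1 t ∂μT =
          C * ENNReal.ofReal (2 * Real.log (T : ℝ) - Real.log (borelHeight y : ℝ) -
            Real.log (borelHeight ((quasiSplit F E c 2).toAdelic w * y) : ℝ)) ∧
        ∫ t, (β t).toReal *
            ((1 : ℝ) - {g : (quasiSplit F E c 2).Adelic | T < borelHeight g}.indicator 1
                ((((t : torusInBorel F E c 2) : borelAdelic F E c 2) : (quasiSplit F E c 2).Adelic) * y) -
              {g : (quasiSplit F E c 2).Adelic | T < borelHeight g}.indicator 1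
                ((quasiSplit F E c 2).toAdelic w *
                  ((((t : torusInBorel F E c 2) : borelAdelic F E c 2) : (quasiSplit F E c 2).Adelic) * y))) ∂μT =
          C.toReal * (2 * Real.log (T : ℝ) - Real.log (borelHeight y : ℝ) -
            Real.log (borelHeight ((quasiSplit F E c 2).toAdelic w * y) : ℝ)) := by
  obtain ⟨S, 𝔎, ρ, hSm, h𝔎, hρc, hκ, hH, hS, hcov⟩ := exists_torusSiegelData_two (F := F) (E := E) (c := c) h2 hc hc1
  obtain ⟨C, hC, hwin⟩ := exists_lintegral_weight_mul_indicator_window_eq μT hβ h𝔎 hρc hκ hH hSm hS hcov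
  exact ⟨C, hC, hwin, fun y T hT =>
    ⟨lintegral_weight_mul_indicator_rankOneWindow_eq_two hw y hT μT hβ.measurable hC hwin,
      integral_weight_toReal_mul_uT_eq_two hw y hT μT hβ.measurable hC hwin⟩⟩

end Packaged

/-! ## §6 (ED. 2) One constant for EVERY covering weight -/

section Uniform

variable [MeasurableSpace (quasiSplit F E c 2).Adelic] [BorelSpace (quasiSplit F E c 2).Adelic]

/-- **The window law does not depend on the covering weight** (★ `lintegral_weight_mul_comp_borelHeight_eq`:
the window indicator is a function of the height, which is invariant under the rational torus): for two
covering weights `β₀, β` of `T(F)_T` and any `A, B`,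
`∫⁻ β · 1_{A < H ≤ B} dμ_T = ∫⁻ β₀ · 1_{A < H ≤ B} dμ_T`. [cite: Arthur1981TraceFormulaInvariantForm, §2] -/
theorem lintegral_weight_mul_indicator_window_eq_of_isCoveringWeight_two (μT : Measure (torusInBorel F E c 2))
    [μT.IsMulLeftInvariant] {β₀ β : torusInBorel F E c 2 → ℝ≥0∞}
    (hβ₀ : IsCoveringWeight ((rationalBorel F E c 2).subgroupOf (torusInBorel F E c 2)) β₀)
    (hβ : IsCoveringWeight ((rationalBorel F E c 2).subgroupOf (torusInBorel F E c 2)) β) (A B : ℝ≥0) :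
    ∫⁻ t, β t * {t : torusInBorel F E c 2 |
        A < borelHeight (((t : torusInBorel F E c 2) : borelAdelic F E c 2) : (quasiSplit F E c 2).Adelic) ∧
        borelHeight (((t : torusInBorel F E c 2) : borelAdelic F E c 2) : (quasiSplit F E c 2).Adelic) ≤ B}.indicator
        1 t ∂μT =
      ∫⁻ t, β₀ t * {t : torusInBorel F E c 2 |
        A < borelHeight (((t : torusInBorel F E c 2) : borelAdelic F E c 2) : (quasiSplit F E c 2).Adelic) ∧
        borelHeight (((t : torusInBorel F E c 2) : borelAdelic F E c 2) : (quasiSplit F E c 2).Adelic) ≤ B}.indicator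
        1 t ∂μT := by
  -- the window indicator is `(Ioc A B).indicator 1 ∘ H`
  have hind : ∀ (β' : torusInBorel F E c 2 → ℝ≥0∞) (t : torusInBorel F E c 2),
      β' t * {t : torusInBorel F E c 2 |
        A < borelHeight (((t : torusInBorel F E c 2) : borelAdelic F E c 2) : (quasiSplit F E c 2).Adelic) ∧
        borelHeight (((t : torusInBorel F E c 2) : borelAdelic F E c 2) : (quasiSplit F E c 2).Adelic) ≤ B}.indicator
        1 t =
      (Set.Ioc A B).indicator (1 : ℝ≥0 → ℝ≥0∞)
          (borelHeight (((t : torusInBorel F E c 2) : borelAdelic F E c 2) : (quasiSplit F E c 2).Adelic)) * β' t := by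
    intro β' t
    -- the two indicators agree definitionally (`t ∈ {t | A < H t ∧ H t ≤ B}` is `H t ∈ Ioc A B`)
    exact mul_comm _ _
  simp_rw [hind]
  exact lintegral_weight_mul_comp_borelHeight_eq μT hβ hβ₀ (measurable_one.indicator measurableSet_Ioc)

/-- **THE RANK-ONE INTERVAL OF `U(J₂)`, ONE CONSTANT FOR EVERY COVERING WEIGHT (ED. 2).** For `[E:F] = 2`,
`c² = 1`, `c ≠ 1`, the Weyl element `w` (`hw`), a left-invariant measure `μ_T` on `T(𝔸_F)` finite on compacts
and ONE covering weight `β₀` of the rational torus `T(F)_T` (to fix the constant), there is `C < ∞` such that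
for EVERY covering weight `β` of `T(F)_T`: (i) the window law `∫⁻ β · 1_{A < H ≤ B} dμ_T = C · (log B − log A)`
(`0 < A ≤ B`) and (ii) for every `y ∈ G(𝔸_F)`, `T ≥ 1`, the rank-one interval
`∫ β(t) u_T(t y) dμ_T(t) = C · (2 log T − log H(y) − log H(w y))` in `[0,∞]` form and in signed form —
uniformity in `β` by §6's weight independence; needed by the unfolding over `T(F)\G(𝔸)` (W2-c), which
meets the translated torus weights `β_y(t) := β(t y)`, one for every `y`.
[cite: Rogawski1990, §6.1 (6.1.1)–(6.1.3)] [cite: Arthur1978TraceFormulaI, §8]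
[cite: Arthur1981TraceFormulaInvariantForm, §2] -/
theorem exists_rankOneInterval_forall_weight_two (h2 : Module.finrank F E = 2) (hc : c * c = 1) (hc1 : c ≠ 1)
    {w : (quasiSplit F E c 2).Rational}
    (hw : ((w.1 : GL (Fin 2) E) : Matrix (Fin 2) (Fin 2) E) = !![(0 : E), 1; 1, 0])
    (μT : Measure (torusInBorel F E c 2)) [μT.IsMulLeftInvariant] [IsFiniteMeasureOnCompacts μT]
    {β₀ : torusInBorel F E c 2 → ℝ≥0∞}
    (hβ₀ : IsCoveringWeight ((rationalBorel F E c 2).subgroupOf (torusInBorel F E c 2)) β₀) :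
    ∃ C : ℝ≥0∞, C ≠ ⊤ ∧
      ∀ β : torusInBorel F E c 2 → ℝ≥0∞,
        IsCoveringWeight ((rationalBorel F E c 2).subgroupOf (torusInBorel F E c 2)) β →
      (∀ A B : ℝ≥0, 0 < A → A ≤ B →
        ∫⁻ t, β t * {t : torusInBorel F E c 2 |
            A < borelHeight (((t : torusInBorel F E c 2) : borelAdelic F E c 2) : (quasiSplit F E c 2).Adelic) ∧
            borelHeight (((t : torusInBorel F E c 2) : borelAdelic F E c 2) : (quasiSplit F E c 2).Adelic) ≤ B}.indicator
            1 t ∂μT =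
          C * ENNReal.ofReal (Real.log (B : ℝ) - Real.log (A : ℝ))) ∧
      ∀ (y : (quasiSplit F E c 2).Adelic) (T : ℝ≥0), 1 ≤ T →
        ∫⁻ t, β t * {t : torusInBorel F E c 2 |
            borelHeight (1 : (quasiSplit F E c 2).Adelic) * borelHeight ((quasiSplit F E c 2).toAdelic w * y) / T ≤
              borelHeight (((t : torusInBorel F E c 2) : borelAdelic F E c 2) : (quasiSplit F E c 2).Adelic) ∧
            borelHeight (((t : torusInBorel F E c 2) : borelAdelic F E c 2) : (quasiSplit F E c 2).Adelic) ≤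
              borelHeight (1 : (quasiSplit F E c 2).Adelic) * T / borelHeight y}.indicator 1 t ∂μT =
          C * ENNReal.ofReal (2 * Real.log (T : ℝ) - Real.log (borelHeight y : ℝ) -
            Real.log (borelHeight ((quasiSplit F E c 2).toAdelic w * y) : ℝ)) ∧
        ∫ t, (β t).toReal *
            ((1 : ℝ) - {g : (quasiSplit F E c 2).Adelic | T < borelHeight g}.indicator 1
                ((((t : torusInBorel F E c 2) : borelAdelic F E c 2) : (quasiSplit F E c 2).Adelic) * y) -
              {g : (quasiSplit F E c 2).Adelic | T < borelHeight g}.indicator 1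
                ((quasiSplit F E c 2).toAdelic w *
                  ((((t : torusInBorel F E c 2) : borelAdelic F E c 2) : (quasiSplit F E c 2).Adelic) * y))) ∂μT =
          C.toReal * (2 * Real.log (T : ℝ) - Real.log (borelHeight y : ℝ) -
            Real.log (borelHeight ((quasiSplit F E c 2).toAdelic w * y) : ℝ)) := by
  obtain ⟨S, 𝔎, ρ, hSm, h𝔎, hρc, hκ, hH, hS, hcov⟩ := exists_torusSiegelData_two (F := F) (E := E) (c := c) h2 hc hc1
  obtain ⟨C, hC, hwin₀⟩ := exists_lintegral_weight_mul_indicator_window_eq μT hβ₀ h𝔎 hρc hκ hH hSm hS hcov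
  refine ⟨C, hC, fun β hβ => ?_⟩
  have hwin : ∀ A B : ℝ≥0, 0 < A → A ≤ B →
      ∫⁻ t, β t * {t : torusInBorel F E c 2 |
          A < borelHeight (((t : torusInBorel F E c 2) : borelAdelic F E c 2) : (quasiSplit F E c 2).Adelic) ∧
          borelHeight (((t : torusInBorel F E c 2) : borelAdelic F E c 2) : (quasiSplit F E c 2).Adelic) ≤ B}.indicator
          1 t ∂μT =
        C * ENNReal.ofReal (Real.log (B : ℝ) - Real.log (A : ℝ)) := fun A B hA hAB => by
    rw [lintegral_weight_mul_indicator_window_eq_of_isCoveringWeight_two μT hβ₀ hβ A B]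
    exact hwin₀ A B hA hAB
  exact ⟨hwin, fun y T hT =>
    ⟨lintegral_weight_mul_indicator_rankOneWindow_eq_two hw y hT μT hβ.measurable hC hwin,
      integral_weight_toReal_mul_uT_eq_two hw y hT μT hβ.measurable hC hwin⟩⟩

end Uniform

end UnitaryGroup

end Literature.NumberTheory.Automorphic
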